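import Summits.QuantumAdvantage.QuantumAdvantage.Theses.DarkClassGroups
import Literature.Computability.Cryptography.ShorProofs
import Literature.Computability.Cryptography.HallgrenClassGroup

/-!
# Sketch — BC2 redirect of `DarkClassGroups.ClassNumberFBQP` (stmt-QuantumAdvantage-11623)

Four typed pieces and the PROVED assembly
`ClassNumberFBQP_of_subs : NoSiegelBright → BrightClassNumberQSolvable → OrderClassNumberFormula →
OrderReduction → ClassNumberFBQP`.
-/

set_option linter.dupNamespace false

namespace Summit.QuantumAdvantage.QuantumAdvantage.Theses.DarkClassGroups.Split

open Summit.QuantumAdvantage.QuantumAdvantage.Theses.DarkClassGroups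

/-- P1 (analytic NT; where GRH is replaced). Under no Siegel zeros for odd real primitive characters,
every negative fundamental discriminant `−d` is BRIGHT: `√d ≤ C · h(−d) · log d` for one absolute `C`
(fundamentality spelled VERBATIM as `Literature.Computability.Cryptography.IsNegFundamentalDiscr d`). -/
def NoSiegelBright : Prop :=
  Summit.RiemannHypothesis.RiemannHypothesis.NoSiegelZerosOddQuadratic → ∃ C : ℕ, ∀ d : ℕ, (((-(d : ℤ)) % 4 = 1 ∧ Squarefree (-(d : ℤ)) ∧ (-(d : ℤ)) ≠ 1) ∨ (4 ∣ (-(d : ℤ)) ∧ ((-(d : ℤ)) / 4 % 4 = 2 ∨ (-(d : ℤ)) / 4 % 4 = 3) ∧ Squarefree ((-(d : ℤ)) / 4))) → Real.sqrt (d : ℝ) ≤ (C : ℝ) * (Literature.NumberTheory.QuadraticFields.BinaryQuadraticForm.classNumber (-(d : ℤ)) : ℝ) * Real.log (d : ℝ)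

/-- P2 (quantum; GRH-free and (i)-free). For every `C`, the class number of a BRIGHT-at-`C` negative
fundamental discriminant is quantum-polynomial, written READABLY as the `|x|` low bits of `h(−d)` (`h(−d) < d < 2^|x|`,
no bit lost; a bare `encodeNat` prefix would be unreadable downstream), on the brightness promise. -/
def BrightClassNumberQSolvable : Prop :=
  ∀ C : ℕ, Literature.Computability.Cryptography.IsQSolvable fun x : List Bool => {y : List Bool | (((-(Computability.decodeNat x : ℤ)) % 4 = 1 ∧ Squarefree (-(Computability.decodeNat x : ℤ)) ∧ (-(Computability.decodeNat x : ℤ)) ≠ 1) ∨ (4 ∣ (-(Computability.decodeNat x : ℤ)) ∧ ((-(Computability.decodeNat x : ℤ)) / 4 % 4 = 2 ∨ (-(Computability.decodeNat x : ℤ)) / 4 % 4 = 3) ∧ Squarefree ((-(Computability.decodeNat x : ℤ)) / 4))) → Real.sqrt (Computability.decodeNat x : ℝ) ≤ (C : ℝ) * (Literature.NumberTheory.QuadraticFields.BinaryQuadraticForm.classNumber (-(Computability.decodeNat x : ℤ)) : ℝ) * Real.log (Computability.decodeNat x : ℝ) → List.ofFn (fun i : Fin x.length => (Literature.NumberTheory.QuadraticFields.BinaryQuadraticForm.classNumber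 (-(Computability.decodeNat x : ℤ))).testBit i.val) <+: y}

/-- P3 (algebraic NT; Cox Thm 7.24 + 7.7 on the tree's form-count `classNumber`). -/
def OrderClassNumberFormula : Prop :=
  ∀ d f : ℕ, (((-(d : ℤ)) % 4 = 1 ∧ Squarefree (-(d : ℤ)) ∧ (-(d : ℤ)) ≠ 1) ∨ (4 ∣ (-(d : ℤ)) ∧ ((-(d : ℤ)) / 4 % 4 = 2 ∨ (-(d : ℤ)) / 4 % 4 = 3) ∧ Squarefree ((-(d : ℤ)) / 4))) → 1 ≤ f → (Literature.NumberTheory.QuadraticFields.BinaryQuadraticForm.classNumber (-((d * f ^ 2 : ℕ) : ℤ)) : ℤ) * (if d = 3 then 6 else if d = 4 then 4 else 2) = (Literature.NumberTheory.QuadraticFields.BinaryQuadraticForm.classNumber (-(d : ℤ)) : ℤ) * (if d * f ^ 2 = 3 then 6 else if d * f ^ 2 = 4 then 4 else 2) * ∏ p ∈ f.primeFactors, ((p : ℤ) ^ (f.factorization p - 1) * ((p : ℤ) - ((Set.ncard {b : ℕ | b < 2 * p ∧ (4 * (p : ℤ)) ∣ ((b : ℤ) ^ 2 + (d : ℤ))}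 : ℤ) - 1)))

/-- P4 (complexity plumbing + Shor). Unconditional reduction of all discriminants to fundamental ones. -/
def OrderReduction : Prop :=
  Literature.Computability.Cryptography.IsQSolvable (fun x : List Bool => {y : List Bool | (((-(Computability.decodeNat x : ℤ)) % 4 = 1 ∧ Squarefree (-(Computability.decodeNat x : ℤ)) ∧ (-(Computability.decodeNat x : ℤ)) ≠ 1) ∨ (4 ∣ (-(Computability.decodeNat x : ℤ)) ∧ ((-(Computability.decodeNat x : ℤ)) / 4 % 4 = 2 ∨ (-(Computability.decodeNat x : ℤ)) / 4 % 4 = 3) ∧ Squarefree ((-(Computability.decodeNat x : ℤ)) / 4))) → List.ofFn (fun i : Fin x.length => (Literature.NumberTheory.QuadraticFields.BinaryQuadraticForm.classNumber (-(Computability.decodeNat x : ℤ))).testBit i.val) <+: y}) → (∀ d f : ℕ, (((-(d : ℤ)) % 4 = 1 ∧ Squarefree (-(d : ℤ)) ∧ (-(d : ℤ)) ≠ 1) ∨ (4 ∣ (-(d : ℤ)) ∧ ((-(d : ℤ)) / 4 % 4 = 2 ∨ (-(d : ℤ)) / 4 % 4 = 3) ∧ Squarefree ((-(d : ℤ)) /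 4))) → 1 ≤ f → (Literature.NumberTheory.QuadraticFields.BinaryQuadraticForm.classNumber (-((d * f ^ 2 : ℕ) : ℤ)) : ℤ) * (if d = 3 then 6 else if d = 4 then 4 else 2) = (Literature.NumberTheory.QuadraticFields.BinaryQuadraticForm.classNumber (-(d : ℤ)) : ℤ) * (if d * f ^ 2 = 3 then 6 else if d * f ^ 2 = 4 then 4 else 2) * ∏ p ∈ f.primeFactors, ((p : ℤ) ^ (f.factorization p - 1) * ((p : ℤ) - ((Set.ncard {b : ℕ | b < 2 * p ∧ (4 * (p : ℤ)) ∣ ((b : ℤ) ^ 2 + (d : ℤ))} : ℤ) - 1)))) → (fun x : List Bool => List.ofFn (fun i : Fin x.length => (Literature.NumberTheory.QuadraticFields.BinaryQuadraticForm.classNumber (-(Computability.decodeNat x : ℤ))).testBit i.val)) ∈ Literature.Computability.Cryptography.FBQP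

/-! ### Sanity: the inline fundamentality clause IS the tree's `IsNegFundamentalDiscr` -/

example (d : ℕ) : ((((-(d : ℤ)) % 4 = 1 ∧ Squarefree (-(d : ℤ)) ∧ (-(d : ℤ)) ≠ 1) ∨ (4 ∣ (-(d : ℤ)) ∧ ((-(d : ℤ)) / 4 % 4 = 2 ∨ (-(d : ℤ)) / 4 % 4 = 3) ∧ Squarefree ((-(d : ℤ)) / 4))) ↔ Literature.Computability.Cryptography.IsNegFundamentalDiscr d) :=
  Iff.rfl

/-- The third antecedent of `OrderReduction` is literally `OrderClassNumberFormula`. -/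
example : OrderReduction = (Literature.Computability.Cryptography.IsQSolvable (fun x : List Bool => {y : List Bool | Literature.Computability.Cryptography.IsNegFundamentalDiscr (Computability.decodeNat x) → List.ofFn (fun i : Fin x.length => (Literature.NumberTheory.QuadraticFields.BinaryQuadraticForm.classNumber (-(Computability.decodeNat x : ℤ))).testBit i.val) <+: y}) → OrderClassNumberFormula → (fun x : List Bool => List.ofFn (fun i : Fin x.length => (Literature.NumberTheory.QuadraticFields.BinaryQuadraticForm.classNumber (-(Computability.decodeNat x : ℤ))).testBit i.val)) ∈ Literature.Computability.Cryptography.FBQP) :=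
  rfl

/-! ### The assembly (PROVED; not a pure modus ponens: brightness-for-all + monotonicity of search solvability) -/

/-- From brightness of every fundamental `−d` (P1's consequent) and solvability on every brightness
promise (P2), the UNPROMISED Hallgren relation is solvable: pick P1's `C`, run P2's family at that `C`,
`IsQSolvable.mono`. -/
theorem fundamental_qsolvable_of_bright
    (hB : ∃ C : ℕ, ∀ d : ℕ, Literature.Computability.Cryptography.IsNegFundamentalDiscr d →
      Real.sqrt (d : ℝ) ≤ (C : ℝ) * (Literature.NumberTheory.QuadraticFields.BinaryQuadraticForm.classNumber (-(d : ℤ)) : ℝ) * Real.log (d : ℝ))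
    (hQ : BrightClassNumberQSolvable) :
    Literature.Computability.Cryptography.IsQSolvable fun x : List Bool =>
      {y : List Bool | Literature.Computability.Cryptography.IsNegFundamentalDiscr (Computability.decodeNat x) →
        List.ofFn (fun i : Fin x.length => (Literature.NumberTheory.QuadraticFields.BinaryQuadraticForm.classNumber (-(Computability.decodeNat x : ℤ))).testBit i.val) <+: y} := by
  obtain ⟨C, hC⟩ := hB
  refine (hQ C).mono fun x y hy => ?_
  intro hfund
  exact hy hfund (hC _ hfund)

/-- **ASSEMBLY** `P1 → P2 → P3 → P4 → ClassNumberFBQP` (the route's antecedents `PrimeClassesSpread`,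
`AbelianGroupOrderFBQP` are not needed; hypothesis (i) feeds P1). -/
theorem ClassNumberFBQP_of_subs (h1 : NoSiegelBright) (h2 : BrightClassNumberQSolvable)
    (h3 : OrderClassNumberFormula) (h4 : OrderReduction) : ClassNumberFBQP := by
  intro _hPCS _hAGO hS
  exact h4 (fundamental_qsolvable_of_bright (h1 hS) h2) h3

end Summit.QuantumAdvantage.QuantumAdvantage.Theses.DarkClassGroups.Split
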